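import Mathlib
import HarnessLib

/-!
# The bridge identity: two-copy Harris form of an extension event = (q−1) × edge–event covariance form of the extended graph

Helper file for crux `stmt-CriticalPhenomena-4575` (new-inequality factory `prim-ineq-gen-1`, gen 15); memo
`run/shared/lean/prim/prim-ineq-gen-1/FINDING-21-low-levels-two-sum.md` §4.8.

Let `G` be a finite graph, `U = [a ~ v]` (more generally the event `[e ∈ cl ω]` of a single-element extension by `e`), `G⁺ = G + e`
with `e` a new edge `av`, and `𝒰` ANY event on the subgraphs of `G` (read on `G⁺` by ignoring `e`).  With `Z_G[h] = ∑_ω q^{k(ω)} h(ω)`: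
adding `e` to `ω` keeps `k` if `U(ω)` and lowers it by one otherwise, so `q·Z_{G⁺}[𝒰] = 2q·Z_G[U ∧ 𝒰] + (q+1)·Z_G[¬U ∧ 𝒰]`, and the
two-copy Harris form `H_G(U,𝒰) = Z_G[U𝒰]·Z_G[1] − Z_G[U]·Z_G[𝒰]` satisfies the BRIDGE IDENTITY
`(q − 1)·H_G(U, 𝒰) = (q Z_{G⁺}[𝒰])·Z_G[1] − (q Z_{G⁺}[1])·Z_G[𝒰]`.
Consequence (memo §4.8): at real `q`, `H_G(U,𝒰) ≥ 0` iff `sign(q−1)·Cov_{G⁺}(1_{e open}, 1_𝒰) ≥ 0` — FKG for `q > 1`, and for `q < 1` exactly the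
edge-versus-increasing-event NEGATIVE association conjectured for random-cluster measures with `q < 1`; so that conjecture implies Harris' inequality
for connection events at `q < 1`, and CONJECTURE (H*) of the memo is the coefficientwise interpolation of the two regimes.
This file proves the identity in the abstract model (a finite configuration type with weights `w ω` standing for `q^{k(ω)}`, a Boolean `U` and an
arbitrary Boolean `V` for `𝒰`), over any commutative ring. (This work, 2026-08-21.)
-/

namespace Summit.CriticalPhenomena.PercolationContinuityZ3.Theorems

namespace TwoCopyEdgeBridge

open Finset BigOperators

variable {R : Type*} [CommRing R] {ι : Type*} [Fintype ι]

/-- Indicator of a Boolean as a ring element. [this work] -/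
def χ (b : Bool) : R := if b then 1 else 0

/-- `Z[U ∧ V]`. [this work] -/
def zUV (w : ι → R) (U V : ι → Bool) : R := ∑ ω, w ω * χ (U ω) * χ (V ω)
/-- `Z[¬U ∧ V]`. [this work] -/
def zNV (w : ι → R) (U V : ι → Bool) : R := ∑ ω, w ω * (1 - χ (U ω)) * χ (V ω)
/-- `Z[U]`. [this work] -/
def zU (w : ι → R) (U : ι → Bool) : R := ∑ ω, w ω * χ (U ω)
/-- `Z[¬U]`. [this work] -/
def zN (w : ι → R) (U : ι → Bool) : R := ∑ ω, w ω * (1 - χ (U ω))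
/-- `Z[V]`. [this work] -/
def zV (w : ι → R) (V : ι → Bool) : R := ∑ ω, w ω * χ (V ω)
/-- `Z[1]`. [this work] -/
def z1 (w : ι → R) : R := ∑ ω, w ω

/-- `q · Z_{G⁺}[V]`: each configuration of `G` contributes once without `e` (weight `q·w`) and once with `e` (weight `q·w` if `U`, i.e. `k`
unchanged, and `w` if `¬U`, i.e. `k` drops by one): pointwise factor `2q` on `U`, `q + 1` on `¬U`. [this work] -/
def qZplusV (q : R) (w : ι → R) (U V : ι → Bool) : R :=
  ∑ ω, w ω * χ (V ω) * (if U ω then 2 * q else q + 1)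

/-- `q · Z_{G⁺}[1]`. [this work] -/
def qZplus1 (q : R) (w : ι → R) (U : ι → Bool) : R := ∑ ω, w ω * (if U ω then 2 * q else q + 1)

omit [Fintype ι] in
/-- Pointwise split of the `G⁺`-weight into the `U` / `¬U` blocks. [this work] -/
theorem pw_plus (q : R) (w : ι → R) (U V : ι → Bool) (ω : ι) :
    w ω * χ (V ω) * (if U ω then 2 * q else q + 1)
      = 2 * q * (w ω * χ (U ω) * χ (V ω)) + (q + 1) * (w ω * (1 - χ (U ω)) * χ (V ω)) := by
  unfold χ; cases U ω <;> cases V ω <;> simp <;> ring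

omit [Fintype ι] in
/-- Pointwise split for `V ≡ true`. [this work] -/
theorem pw_plus1 (q : R) (w : ι → R) (U : ι → Bool) (ω : ι) :
    w ω * (if U ω then 2 * q else q + 1) = 2 * q * (w ω * χ (U ω)) + (q + 1) * (w ω * (1 - χ (U ω))) := by
  unfold χ; cases U ω <;> simp <;> ring

/-- Block form of `q Z_{G⁺}[V] = 2q·Z[U∧V] + (q+1)·Z[¬U∧V]`. [this work] -/
theorem qZplusV_eq (q : R) (w : ι → R) (U V : ι → Bool) :
    qZplusV q w U V = 2 * q * zUV w U V + (q + 1) * zNV w U V := by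
  unfold qZplusV zUV zNV; simp_rw [pw_plus]; rw [Finset.sum_add_distrib, ← Finset.mul_sum, ← Finset.mul_sum]

/-- Block form of `q Z_{G⁺}[1] = 2q·Z[U] + (q+1)·Z[¬U]`. [this work] -/
theorem qZplus1_eq (q : R) (w : ι → R) (U : ι → Bool) :
    qZplus1 q w U = 2 * q * zU w U + (q + 1) * zN w U := by
  unfold qZplus1 zU zN; simp_rw [pw_plus1]; rw [Finset.sum_add_distrib, ← Finset.mul_sum, ← Finset.mul_sum]

/-- `Z[V] = Z[U∧V] + Z[¬U∧V]`. [this work] -/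
theorem zV_split (w : ι → R) (U V : ι → Bool) : zV w V = zUV w U V + zNV w U V := by
  unfold zV zUV zNV; rw [← Finset.sum_add_distrib]; apply Finset.sum_congr rfl; intro ω _; ring

/-- `Z[1] = Z[U] + Z[¬U]`. [this work] -/
theorem z1_split (w : ι → R) (U : ι → Bool) : z1 w = zU w U + zN w U := by
  unfold z1 zU zN; rw [← Finset.sum_add_distrib]; apply Finset.sum_congr rfl; intro ω _; ring

/-- THE BRIDGE IDENTITY: `(q − 1)·(Z[U∧V]·Z[1] − Z[U]·Z[V]) = (q Z⁺[V])·Z[1] − (q Z⁺[1])·Z[V]`.  Its left factor is the two-copy Harris form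
`H_G(U,V)`; its right side is `q·Z[1]·Z⁺[1]·(φ_{G⁺}(V) − φ_G(V))` up to normalisation, i.e. `q Z Z⁺` times the covariance-type difference
between the extended graph and the original (= conditioning on `e` closed). [this work] -/
theorem bridge (q : R) (w : ι → R) (U V : ι → Bool) :
    (q - 1) * (zUV w U V * z1 w - zU w U * zV w V) = qZplusV q w U V * z1 w - qZplus1 q w U * zV w V := by
  rw [qZplusV_eq, qZplus1_eq, zV_split w U V, z1_split w U]
  ring

end TwoCopyEdgeBridge

end Summit.CriticalPhenomena.PercolationContinuityZ3.Theorems
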